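import Mathlib
import Literature.NumberTheory.DiophantineGeometry.TensorWordModel
import HarnessLib

/-!
# Cayley parameters for the centraliser-isometry group of `(S, G)` — definitions and ring-level algebra

Helper for the crux `PowersHodgeOfDeckCommutators` (stmt-HodgeConjecture-19545, route `CyclicUnitaryPowers`,
line `unitary-kunneth-fft`, stub U `stub_unitaryHodgeTensorFFT`), part 1 of 3 of the DENSITY step of the
unitary tensor FFT done with Cayley parameters instead of Zariski closures (Goodman–Wallach, GTM 255,
Exercises 1.4.5 #5 and §2.2.3 Exercise 1 «Cayley parameters»).

For matrices `S` (the deck transformation) and `G` (a symmetric Gram matrix with `Sᵀ G S = G`):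
* `cayleyNum X = (1 - X) adj(1 + X)`, `cayleyInvNum X = (1 + X) adj(1 - X)`, `cayley X = (1 - X)(1 + X)⁻¹`;
  for `G`-skew `X`, `cayleyNum(X)ᵀ G cayleyNum(X) = det(1+X)² G` (`cayleyNum_transpose_mul_mul`);
* `rho S Si G Gi p = cycAvg ∘ skewPart`, a universal `ℤ`-linear formula (`Si, Gi` stand for `S⁻¹, G⁻¹`) whose
  values commute with `S` and are `G`-skew (`rho_comm`, `rho_skew`) and which is `2p` times the identity on
  that Lie algebra (`rho_of_mem`) — so over EVERY `ℚ`-algebra the Lie algebra `{X : XS = SX, XᵀG + GX = 0}` is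
  the image of `ρ`, with no base change of kernels;
* `uNum`, `uDen`: numerator and denominator of the commutator of the Cayley transforms of `ρ A`, `ρ B`, and
  their naturality under ring maps (`map_uNum`, `map_uDen`);
* the generic matrices `genA`, `genB` in the variables `Vars N` and the polynomials `innerPoly`, `denPoly`
  used by the generic identity (part 2, `CyclicUnitaryPowersCommutatorIdentity`).
-/

noncomputable section

open Matrix MvPolynomial
open scoped BigOperators

namespace Summit.HodgeConjecture.HodgeConjecture.Theorems.CyclicUnitaryPowersCayleyParameters

variable {n : Type*} [Fintype n] [DecidableEq n]

/-! ### §1 Cayley numerators over a commutative ring -/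

section Cayley

variable {R : Type*} [CommRing R]

/-- The Cayley numerator `(1 - X) · adj(1 + X)` (= `det(1+X) · (1 - X)(1 + X)⁻¹` when `1 + X` is
invertible). [cite: GoodmanWallachGTM255, Exercises 1.4.5 #5] -/
def cayleyNum (X : Matrix n n R) : Matrix n n R := (1 - X) * (1 + X).adjugate

/-- The inverse Cayley numerator `(1 + X) · adj(1 - X)` (= `det(1-X) · ((1 - X)(1 + X)⁻¹)⁻¹`).
[cite: GoodmanWallachGTM255, Exercises 1.4.5 #5] -/
def cayleyInvNum (X : Matrix n n R) : Matrix n n R := (1 + X) * (1 - X).adjugate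

omit [DecidableEq n] in
/-- For a `G`-skew `X`, `(1 - X)ᵀ G (1 - X) = (1 + X)ᵀ G (1 + X)` (both equal `G + Xᵀ G X`).
[cite: GoodmanWallachGTM255, Exercises 1.4.5 #5] -/
theorem transpose_sub_mul_mul_sub_eq [DecidableEq n] {G X : Matrix n n R} (h : Xᵀ * G + G * X = 0) :
    (1 - X)ᵀ * G * (1 - X) = (1 + X)ᵀ * G * (1 + X) := by
  have h' : Xᵀ * G = -(G * X) := eq_neg_of_add_eq_zero_left h
  rw [transpose_sub, transpose_add, transpose_one]
  simp only [sub_mul, mul_sub, add_mul, mul_add, one_mul, mul_one, h']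
  abel

/-- **Cayley isometry** (numerator form): for a `G`-skew `X`,
`cayleyNum(X)ᵀ G cayleyNum(X) = det(1 + X)² · G`. [cite: GoodmanWallachGTM255, Exercises 1.4.5 #5] -/
theorem cayleyNum_transpose_mul_mul {G X : Matrix n n R} (h : Xᵀ * G + G * X = 0) :
    (cayleyNum X)ᵀ * G * cayleyNum X = ((1 + X).det ^ 2) • G := by
  unfold cayleyNum
  rw [transpose_mul]
  have e : (1 + X).adjugateᵀ * (1 - X)ᵀ * G * ((1 - X) * (1 + X).adjugate)
      = (1 + X).adjugateᵀ * ((1 - X)ᵀ * G * (1 - X)) * (1 + X).adjugate := by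
    simp only [Matrix.mul_assoc]
  rw [e, transpose_sub_mul_mul_sub_eq h]
  have e2 : (1 + X).adjugateᵀ * ((1 + X)ᵀ * G * (1 + X)) * (1 + X).adjugate
      = ((1 + X) * (1 + X).adjugate)ᵀ * G * ((1 + X) * (1 + X).adjugate) := by
    rw [transpose_mul]; simp only [Matrix.mul_assoc]
  rw [e2, mul_adjugate, transpose_smul, transpose_one, smul_mul_assoc, one_mul, Matrix.mul_smul, mul_one,
    smul_smul, sq]

/-- `cayleyNum X * cayleyInvNum X = det(1+X) det(1-X) · 1`. [cite: GoodmanWallachGTM255, Exercises 1.4.5 #5] -/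
theorem cayleyNum_mul_cayleyInvNum (X : Matrix n n R) :
    cayleyNum X * cayleyInvNum X = ((1 + X).det * (1 - X).det) • (1 : Matrix n n R) := by
  unfold cayleyNum cayleyInvNum
  calc (1 - X) * (1 + X).adjugate * ((1 + X) * (1 - X).adjugate)
      = (1 - X) * ((1 + X).adjugate * (1 + X)) * (1 - X).adjugate := by simp only [Matrix.mul_assoc]
    _ = (1 + X).det • ((1 - X) * (1 - X).adjugate) := by
        rw [adjugate_mul, Matrix.mul_smul, mul_one, smul_mul_assoc]
    _ = ((1 + X).det * (1 - X).det) • (1 : Matrix n n R) := by rw [mul_adjugate, smul_smul]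

end Cayley

/-! ### §2 The Cayley transform over a field (definition; its properties are in part 2) -/

section Field

variable {K : Type*} [Field K]

/-- The Cayley transform `(1 - X)(1 + X)⁻¹`. [cite: GoodmanWallachGTM255, Exercises 1.4.5 #5] -/
def cayley (X : Matrix n n K) : Matrix n n K := (1 - X) * (1 + X)⁻¹

end Field

/-! ### §3 The universal linear map `ρ` onto the Lie algebra `𝔲 = {X : XS = SX, Xᵀ G + G X = 0}` -/

section Rho

variable {R : Type*} [CommRing R]

/-- The `G`-skew part `M - G⁻¹ Mᵀ G` (with `Gi` standing for `G⁻¹`). [cite: GoodmanWallachGTM255, Exercises 1.4.5 #5] -/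
def skewPart (G Gi M : Matrix n n R) : Matrix n n R := M - Gi * Mᵀ * G

/-- The cyclic average `Σ_{i<p} Sⁱ M Siⁱ` (with `Si` standing for `S⁻¹`). [cite: GoodmanWallachGTM255, §2.2.3 Exercise 1] -/
def cycAvg (S Si : Matrix n n R) (p : ℕ) (M : Matrix n n R) : Matrix n n R :=
  ∑ i ∈ Finset.range p, S ^ i * M * Si ^ i

/-- `ρ = cycAvg ∘ skewPart`: a universal `ℤ`-linear formula whose image is the Lie algebra `𝔲`.
[cite: GoodmanWallachGTM255, §2.2.3 Exercise 1] -/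
def rho (S Si G Gi : Matrix n n R) (p : ℕ) (M : Matrix n n R) : Matrix n n R :=
  cycAvg S Si p (skewPart G Gi M)

/-- The skew part is `G`-skew (for `G` symmetric with inverse `Gi`). [cite: GoodmanWallachGTM255, Exercises 1.4.5 #5] -/
theorem skewPart_skew {G Gi : Matrix n n R} (hGt : Gᵀ = G) (hGit : Giᵀ = Gi) (hGGi : G * Gi = 1)
    (hGiG : Gi * G = 1) (M : Matrix n n R) :
    (skewPart G Gi M)ᵀ * G + G * skewPart G Gi M = 0 := by
  unfold skewPart
  rw [transpose_sub, transpose_mul, transpose_mul, transpose_transpose, hGt, hGit, sub_mul, mul_sub]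
  simp only [Matrix.mul_assoc]
  rw [hGiG, Matrix.mul_one, ← Matrix.mul_assoc G Gi, hGGi, Matrix.one_mul]
  abel

/-- If `S Si = 1 = Si S` and `S ^ p = 1` then `Si ^ p = 1`. [folklore] -/
theorem inv_pow_eq_one {S Si : Matrix n n R} {p : ℕ} (hSp : S ^ p = 1) (hSSi : S * Si = 1)
    (hSiS : Si * S = 1) : Si ^ p = 1 := by
  have hc : Commute Si S := by rw [Commute, SemiconjBy, hSiS, hSSi]
  have h : Si ^ p * S ^ p = 1 := by rw [← hc.mul_pow, hSiS, one_pow]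
  rwa [hSp, mul_one] at h

/-- Cyclic shift: `Σ_{i<p} S^{i+1} M Si^{i+1} = Σ_{i<p} Sⁱ M Siⁱ` when `S ^ p = 1 = Si ^ p`. [folklore] -/
theorem sum_shift {S Si : Matrix n n R} {p : ℕ} (hSp : S ^ p = 1) (hSip : Si ^ p = 1) (M : Matrix n n R) :
    ∑ i ∈ Finset.range p, S ^ (i + 1) * M * Si ^ (i + 1) = ∑ i ∈ Finset.range p, S ^ i * M * Si ^ i := by
  have h1 := Finset.sum_range_succ' (fun i => S ^ i * M * Si ^ i) p
  have h2 := Finset.sum_range_succ (fun i => S ^ i * M * Si ^ i) p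
  rw [hSp, hSip] at h2
  rw [pow_zero, pow_zero, h2] at h1
  exact (add_right_cancel h1).symm

/-- The cyclic average commutes with `S` (for `S ^ p = 1`, `S Si = 1 = Si S`).
[cite: GoodmanWallachGTM255, §2.2.3 Exercise 1] -/
theorem cycAvg_comm {S Si : Matrix n n R} {p : ℕ} (hSp : S ^ p = 1) (hSSi : S * Si = 1) (hSiS : Si * S = 1)
    (M : Matrix n n R) : cycAvg S Si p M * S = S * cycAvg S Si p M := by
  have hSip : Si ^ p = 1 := inv_pow_eq_one hSp hSSi hSiS
  unfold cycAvg
  have key : S * (∑ i ∈ Finset.range p, S ^ i * M * Si ^ i) * Si = ∑ i ∈ Finset.range p, S ^ i * M * Si ^ i := by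
    rw [Finset.mul_sum, Finset.sum_mul]
    have hf : ∀ i, S * (S ^ i * M * Si ^ i) * Si = S ^ (i + 1) * M * Si ^ (i + 1) := fun i => by
      rw [pow_succ', pow_succ]; simp only [Matrix.mul_assoc]
    simp_rw [hf]
    exact sum_shift hSp hSip M
  calc (∑ i ∈ Finset.range p, S ^ i * M * Si ^ i) * S
      = S * (∑ i ∈ Finset.range p, S ^ i * M * Si ^ i) * Si * S := by rw [key]
    _ = S * ∑ i ∈ Finset.range p, S ^ i * M * Si ^ i := by rw [Matrix.mul_assoc, hSiS, Matrix.mul_one]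

/-- Transposed powers against `G`: `(Sⁱ)ᵀ G = G Siⁱ` (from `Sᵀ G S = G`). [cite: GoodmanWallachGTM255, Exercises 1.4.5 #5] -/
theorem transpose_pow_mul_G {S Si G : Matrix n n R} (hSG : Sᵀ * G * S = G) (hSSi : S * Si = 1) (i : ℕ) :
    (S ^ i)ᵀ * G = G * Si ^ i := by
  have h1 : Sᵀ * G = G * Si := by
    calc Sᵀ * G = Sᵀ * G * (S * Si) := by rw [hSSi, Matrix.mul_one]
      _ = G * Si := by rw [← Matrix.mul_assoc, hSG]
  induction i with
  | zero => simp
  | succ k ih =>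
    rw [pow_succ', transpose_mul, Matrix.mul_assoc, h1, ← Matrix.mul_assoc, ih, Matrix.mul_assoc, ← pow_succ]

/-- Transposed inverse powers against `G`: `(Siⁱ)ᵀ G = G Sⁱ` (from `Sᵀ G S = G`). [cite: GoodmanWallachGTM255, Exercises 1.4.5 #5] -/
theorem transpose_inv_pow_mul_G {S Si G : Matrix n n R} (hSG : Sᵀ * G * S = G) (hSSi : S * Si = 1) (i : ℕ) :
    (Si ^ i)ᵀ * G = G * S ^ i := by
  have h1 : Siᵀ * G = G * S := by
    have ht : Siᵀ * Sᵀ = 1 := by rw [← transpose_mul, hSSi, transpose_one]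
    calc Siᵀ * G = Siᵀ * (Sᵀ * G * S) := by rw [hSG]
      _ = G * S := by rw [← Matrix.mul_assoc, ← Matrix.mul_assoc, ht, Matrix.one_mul]
  induction i with
  | zero => simp
  | succ k ih =>
    rw [pow_succ', transpose_mul, Matrix.mul_assoc, h1, ← Matrix.mul_assoc, ih, Matrix.mul_assoc, ← pow_succ]

/-- The cyclic average of a `G`-skew matrix is `G`-skew. [cite: GoodmanWallachGTM255, §2.2.3 Exercise 1] -/
theorem cycAvg_skew {S Si G : Matrix n n R} {p : ℕ} (hSG : Sᵀ * G * S = G) (hSSi : S * Si = 1)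
    {Y : Matrix n n R} (hY : Yᵀ * G + G * Y = 0) : (cycAvg S Si p Y)ᵀ * G + G * cycAvg S Si p Y = 0 := by
  unfold cycAvg
  rw [Matrix.transpose_sum, Finset.sum_mul, Finset.mul_sum, ← Finset.sum_add_distrib]
  refine Finset.sum_eq_zero fun i _ => ?_
  have hY' : Yᵀ * G = -(G * Y) := eq_neg_of_add_eq_zero_left hY
  rw [transpose_mul, transpose_mul, Matrix.mul_assoc ((Si ^ i)ᵀ) (Yᵀ * (S ^ i)ᵀ) G,
    Matrix.mul_assoc Yᵀ ((S ^ i)ᵀ) G, transpose_pow_mul_G hSG hSSi, ← Matrix.mul_assoc Yᵀ G (Si ^ i), hY',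
    neg_mul, Matrix.mul_neg, ← Matrix.mul_assoc ((Si ^ i)ᵀ) (G * Y) (Si ^ i), ← Matrix.mul_assoc ((Si ^ i)ᵀ) G Y,
    transpose_inv_pow_mul_G hSG hSSi]
  simp only [Matrix.mul_assoc]
  exact neg_add_cancel _

/-- `ρ M` commutes with `S`. [cite: GoodmanWallachGTM255, §2.2.3 Exercise 1] -/
theorem rho_comm {S Si G Gi : Matrix n n R} {p : ℕ} (hSp : S ^ p = 1) (hSSi : S * Si = 1) (hSiS : Si * S = 1)
    (M : Matrix n n R) : rho S Si G Gi p M * S = S * rho S Si G Gi p M :=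
  cycAvg_comm hSp hSSi hSiS _

/-- `ρ M` is `G`-skew. [cite: GoodmanWallachGTM255, §2.2.3 Exercise 1] -/
theorem rho_skew {S Si G Gi : Matrix n n R} {p : ℕ} (hSG : Sᵀ * G * S = G) (hSSi : S * Si = 1) (hGt : Gᵀ = G)
    (hGit : Giᵀ = Gi) (hGGi : G * Gi = 1) (hGiG : Gi * G = 1) (M : Matrix n n R) :
    (rho S Si G Gi p M)ᵀ * G + G * rho S Si G Gi p M = 0 :=
  cycAvg_skew hSG hSSi (skewPart_skew hGt hGit hGGi hGiG M)

/-- `ρ` is the identity on `𝔲` up to the factor `2p`: `ρ Y = (2p) • Y` for `Y` commuting with `S` and `G`-skew.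
[cite: GoodmanWallachGTM255, §2.2.3 Exercise 1] -/
theorem rho_of_mem {S Si G Gi : Matrix n n R} {p : ℕ} (hSSi : S * Si = 1) (hSiS : Si * S = 1) (hGiG : Gi * G = 1)
    {Y : Matrix n n R} (hYS : Y * S = S * Y) (hY : Yᵀ * G + G * Y = 0) :
    rho S Si G Gi p Y = (2 * p : ℕ) • Y := by
  have hskew : skewPart G Gi Y = (2 : ℕ) • Y := by
    unfold skewPart
    have hY' : Yᵀ * G = -(G * Y) := eq_neg_of_add_eq_zero_left hY
    rw [Matrix.mul_assoc, hY', Matrix.mul_neg, ← Matrix.mul_assoc, hGiG, Matrix.one_mul, sub_neg_eq_add, two_nsmul]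
  have hcomm : ∀ i : ℕ, S ^ i * Y * Si ^ i = Y := by
    intro i
    have hc : S ^ i * Y = Y * S ^ i := by
      induction i with
      | zero => simp
      | succ k ih => rw [pow_succ, Matrix.mul_assoc, ← hYS, ← Matrix.mul_assoc, ih, Matrix.mul_assoc]
    have hSSi' : S ^ i * Si ^ i = 1 := by
      rw [← (show Commute S Si from by rw [Commute, SemiconjBy, hSSi, hSiS]).mul_pow, hSSi, one_pow]
    rw [hc, Matrix.mul_assoc, hSSi', Matrix.mul_one]
  unfold rho cycAvg
  simp_rw [hskew, Matrix.mul_smul, Matrix.smul_mul, hcomm]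
  rw [Finset.sum_const, Finset.card_range, smul_smul, mul_comm]

/-- `ρ` is linear over scalars. [folklore] -/
theorem rho_smul (S Si G Gi : Matrix n n R) (p : ℕ) (a : R) (M : Matrix n n R) :
    rho S Si G Gi p (a • M) = a • rho S Si G Gi p M := by
  unfold rho cycAvg skewPart
  rw [Finset.smul_sum]
  refine Finset.sum_congr rfl fun i _ => ?_
  rw [transpose_smul, Matrix.mul_smul, Matrix.smul_mul, ← smul_sub, Matrix.mul_smul, Matrix.smul_mul]

end Rho

/-! ### §4 The commutator numerator/denominator of two `ρ`-parametrised Cayley transforms; naturality -/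

section Universal

variable {R R' : Type*} [CommRing R] [CommRing R']

/-- Numerator of the commutator `[c(ρA), c(ρB)]` (a polynomial in the entries of `A, B`).
[cite: GoodmanWallachGTM255, §2.2.3 Exercise 1] -/
def uNum (S Si G Gi : Matrix n n R) (p : ℕ) (A B : Matrix n n R) : Matrix n n R :=
  cayleyNum (rho S Si G Gi p A) * cayleyNum (rho S Si G Gi p B) * cayleyInvNum (rho S Si G Gi p A) *
    cayleyInvNum (rho S Si G Gi p B)

/-- Denominator of the commutator `[c(ρA), c(ρB)]`. [cite: GoodmanWallachGTM255, §2.2.3 Exercise 1] -/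
def uDen (S Si G Gi : Matrix n n R) (p : ℕ) (A B : Matrix n n R) : R :=
  (1 + rho S Si G Gi p A).det * (1 + rho S Si G Gi p B).det * (1 - rho S Si G Gi p A).det *
    (1 - rho S Si G Gi p B).det

/-- Naturality of `skewPart`. [folklore] -/
theorem map_skewPart (f : R →+* R') (G Gi M : Matrix n n R) :
    f.mapMatrix (skewPart G Gi M) = skewPart (f.mapMatrix G) (f.mapMatrix Gi) (f.mapMatrix M) := by
  unfold skewPart
  rw [map_sub, map_mul, map_mul]
  simp only [RingHom.mapMatrix_apply, Matrix.transpose_map]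

/-- Naturality of `cycAvg`. [folklore] -/
theorem map_cycAvg (f : R →+* R') (S Si : Matrix n n R) (p : ℕ) (M : Matrix n n R) :
    f.mapMatrix (cycAvg S Si p M) = cycAvg (f.mapMatrix S) (f.mapMatrix Si) p (f.mapMatrix M) := by
  unfold cycAvg
  rw [map_sum]
  simp only [map_mul, map_pow]

/-- Naturality of `ρ`. [folklore] -/
theorem map_rho (f : R →+* R') (S Si G Gi : Matrix n n R) (p : ℕ) (M : Matrix n n R) :
    f.mapMatrix (rho S Si G Gi p M) =
      rho (f.mapMatrix S) (f.mapMatrix Si) (f.mapMatrix G) (f.mapMatrix Gi) p (f.mapMatrix M) := by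
  unfold rho
  rw [map_cycAvg, map_skewPart]

/-- Naturality of `cayleyNum`. [folklore] -/
theorem map_cayleyNum (f : R →+* R') (X : Matrix n n R) : f.mapMatrix (cayleyNum X) = cayleyNum (f.mapMatrix X) := by
  unfold cayleyNum
  rw [map_mul, RingHom.map_adjugate, map_sub, map_add, map_one]

/-- Naturality of `cayleyInvNum`. [folklore] -/
theorem map_cayleyInvNum (f : R →+* R') (X : Matrix n n R) :
    f.mapMatrix (cayleyInvNum X) = cayleyInvNum (f.mapMatrix X) := by
  unfold cayleyInvNum
  rw [map_mul, RingHom.map_adjugate, map_sub, map_add, map_one]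

/-- Naturality of `uNum`. [folklore] -/
theorem map_uNum (f : R →+* R') (S Si G Gi : Matrix n n R) (p : ℕ) (A B : Matrix n n R) :
    f.mapMatrix (uNum S Si G Gi p A B) =
      uNum (f.mapMatrix S) (f.mapMatrix Si) (f.mapMatrix G) (f.mapMatrix Gi) p (f.mapMatrix A) (f.mapMatrix B) := by
  unfold uNum
  rw [map_mul, map_mul, map_mul, map_cayleyNum, map_cayleyNum, map_cayleyInvNum, map_cayleyInvNum, map_rho, map_rho]

/-- Naturality of `uDen`. [folklore] -/
theorem map_uDen (f : R →+* R') (S Si G Gi : Matrix n n R) (p : ℕ) (A B : Matrix n n R) :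
    f (uDen S Si G Gi p A B) =
      uDen (f.mapMatrix S) (f.mapMatrix Si) (f.mapMatrix G) (f.mapMatrix Gi) p (f.mapMatrix A) (f.mapMatrix B) := by
  unfold uDen
  rw [map_mul, map_mul, map_mul, RingHom.map_det, RingHom.map_det, RingHom.map_det, RingHom.map_det, map_add,
    map_add, map_sub, map_sub, map_one, map_rho, map_rho]

/-- At `A = B = 0` the denominator is `1`. [folklore] -/
theorem uDen_zero (S Si G Gi : Matrix n n R) (p : ℕ) : uDen S Si G Gi p 0 0 = 1 := by
  have h : rho S Si G Gi p 0 = 0 := by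
    unfold rho cycAvg skewPart
    simp
  unfold uDen
  rw [h, add_zero, sub_zero, det_one]; ring

end Universal

/-! ### §5 Generic matrices and the generic polynomials -/

section Generic

open Literature.NumberTheory.DiophantineGeometry (tensorPowerMatrix)

variable {N : ℕ}

/-- The variables: the entries of two `N × N` matrices. [folklore] -/
abbrev Vars (N : ℕ) : Type := (Fin N × Fin N) ⊕ (Fin N × Fin N)

/-- The first generic matrix. [folklore] -/
def genA : Matrix (Fin N) (Fin N) (MvPolynomial (Vars N) ℚ) := Matrix.of fun i j => X (Sum.inl (i, j))

/-- The second generic matrix. [folklore] -/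
def genB : Matrix (Fin N) (Fin N) (MvPolynomial (Vars N) ℚ) := Matrix.of fun i j => X (Sum.inr (i, j))

/-- The point of the variable space given by a pair of matrices. [folklore] -/
def pt {K : Type*} (A B : Matrix (Fin N) (Fin N) K) : Vars N → K :=
  Sum.elim (fun ij => A ij.1 ij.2) (fun ij => B ij.1 ij.2)

/-- The inner polynomial `((uNum)^{⊗r} c)(w') − uDen ^ r · c(w')` in the entries of two generic matrices.
[cite: GoodmanWallachGTM255, §2.2.3 Exercise 1] -/
def innerPoly (S Si G Gi : Matrix (Fin N) (Fin N) ℚ) (p r : ℕ) (c : (Fin r → Fin N) → ℚ)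
    (w' : Fin r → Fin N) : MvPolynomial (Vars N) ℚ :=
  (tensorPowerMatrix (MvPolynomial (Vars N) ℚ) N r
      (uNum (S.map (algebraMap ℚ _)) (Si.map (algebraMap ℚ _)) (G.map (algebraMap ℚ _))
        (Gi.map (algebraMap ℚ _)) p genA genB) *ᵥ (fun w => algebraMap ℚ _ (c w))) w' -
    uDen (S.map (algebraMap ℚ _)) (Si.map (algebraMap ℚ _)) (G.map (algebraMap ℚ _))
        (Gi.map (algebraMap ℚ _)) p genA genB ^ r * algebraMap ℚ _ (c w')

/-- The denominator polynomial `uDen` in the entries of two generic matrices. [cite: GoodmanWallachGTM255, §2.2.3 Exercise 1] -/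
def denPoly (S Si G Gi : Matrix (Fin N) (Fin N) ℚ) (p : ℕ) : MvPolynomial (Vars N) ℚ :=
  uDen (S.map (algebraMap ℚ _)) (Si.map (algebraMap ℚ _)) (G.map (algebraMap ℚ _)) (Gi.map (algebraMap ℚ _)) p
    genA genB

end Generic

end Summit.HodgeConjecture.HodgeConjecture.Theorems.CyclicUnitaryPowersCayleyParameters

end
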